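import Summits.CriticalPhenomena.PercolationContinuityZ3.Theorems.PercAnnulusCrossingIICShellVolumesMixedMoments
import HarnessLib

/-!
# Mixed moments of the shell volumes of Kesten's IIC: the `CU⁺_l + UAD` form and the planar case (lane RSW3, p1 gen 19)

builds on p205010 (kernel theorem, internal audit signed; external expert review pending) — NOT used in this file (only `p_c(ℤ^d) > 0`;
planar inputs are RSW at `p_c(ℤ²) = 1/2`).

RSW3 lane (LANE 3 `prim-rsw3`), seat `prim-rsw3-p1` (gen 19).  Helper file (`--supports stmt-CriticalPhenomena-4575`);
no definitions, no sorries.  Memo `run/shared/lean/prim/rsw3/P1-QM.md` §32.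

* `exists_integral_prod_shellVolume_le_criticalProbI_of_robustCondAnnulusUniq` — gen 19 (14) from `CU⁺_l + UAD` alone (`CU⁺_l ⇒ (A2)□(l,l²)`);
* **`exists_integral_prod_shellVolume_le_Z2`** — `ℤ²`, `p_c = 1/2`, UNCONDITIONAL: **`E_ν[∏_{i<k} V_{R_i}] ≤ A·K^k·∏_{i<k} E_ν[V_{R_i}]`** for the shell
  volumes of Kesten's planar IIC at separated scales (`CU⁺_9`, UAD and (A2)□ from RSW).
References: H. Kesten, Probab. Theory Relat. Fields 73 (1986), Thm. (8); G. Grimmett, *Percolation* (1999), §11.7.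
-/

noncomputable section

namespace Summit.CriticalPhenomena.PercolationContinuityZ3.Theorems.Crossing

open MeasureTheory Filter Topology Literature.Probability.Percolation Literature.Probability.LatticeModels
open Literature.Probability.Percolation.DCT16
open Summit.CriticalPhenomena.PercolationContinuityZ3.Theorems.SurfaceTension

variable {d : ℕ}

open Classical in
/-- **MIXED MOMENTS OF SHELL VOLUMES FROM `CU⁺_l + UAD` ALONE** (`p_c(ℤ^d)`, `d ≥ 2`, `CU⁺_l(c_U)`, `l ≥ 2`, `c_U > 0`, UAD): there are `ρ', R₀ ≥ 1` and
`A, K > 0` with `E_ν[∏_i V_{R_i}] ≤ A·K^k·∏_i E_ν[V_{R_i}]` for every IIC measure `ν`, `k ≥ 1`, radii `R_0 ≥ R₀`, `ρ'R_i ≤ R_{i+1}`.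
[cite: Kesten1986, Thm. (8)] -/
theorem exists_integral_prod_shellVolume_le_criticalProbI_of_robustCondAnnulusUniq (hd : 2 ≤ d) {l : ℕ} (hl : 2 ≤ l) {cU : ℝ} (hcU : 0 < cU)
    (hCU : ∀ a : ℕ, 1 ≤ a → ∀ E : Set (BondConfig (Site d)), IsUpperSet E → MeasurableSet E →
      cU * (bondPercolation (zdGraph d) (criticalProbI d)).real E ≤ (bondPercolation (zdGraph d) (criticalProbI d)).real (E ∩
        {ω : BondConfig (Site d) | ∀ t ∈ innerBoundary (zdGraph d) (box d a), ∀ s ∈ innerBoundary (zdGraph d) (box d (l * a)),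
          ∀ t' ∈ innerBoundary (zdGraph d) (box d a), ∀ s' ∈ innerBoundary (zdGraph d) (box d (l * a)),
          ω ∈ openConnIn (↑((box d (l * a) \ box d a) ∪ innerBoundary (zdGraph d) (box d a)) : Set (Site d)) t s →
          ω ∈ openConnIn (↑((box d (l * a) \ box d a) ∪ innerBoundary (zdGraph d) (box d a)) : Set (Site d)) t' s' →
          ω ∈ openConnIn (↑((box d (l * a) \ box d a) ∪ innerBoundary (zdGraph d) (box d a)) : Set (Site d)) s s'}))
    (hUAD : ∀ ε : ℝ, 0 < ε → ∃ K₀ : ℕ, ∀ m : ℕ, 1 ≤ m → ∀ N : ℕ, K₀ * m ≤ N →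
      (bondPercolation (zdGraph d) (criticalProbI d)).real (boxCrossing d m N) ≤ ε) :
    ∃ (ρ' R₀ : ℕ) (A K : ℝ), 1 ≤ ρ' ∧ 1 ≤ R₀ ∧ 0 < A ∧ 0 < K ∧ ∀ (ν : Measure (BondConfig (Site d))) [IsFiniteMeasure ν],
      (∀ (F : Finset (Sym2 (Site d))) (E : Set (BondConfig (Site d))), MeasurableSet E → DeterminedBy E ↑F →
        Tendsto (fun n : ℕ => (bondPercolation (zdGraph d) (criticalProbI d)).real (E ∩ siteToBoundary d n) /
          oneArmProb d (criticalProbI d) n) atTop (𝓝 (ν.real E))) →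
      ∀ (k : ℕ), 1 ≤ k → ∀ (R : Fin k → ℕ), (∀ i, R₀ ≤ R i) → (∀ i j : Fin k, i.val + 1 = j.val → ρ' * R i ≤ R j) →
        ∫ ω, ∏ i : Fin k, ((((box d (2 * R i) \ box d (R i)).filter fun x =>
            ω ∈ (openConn (0 : Site d) x : Set (BondConfig (Site d)))).card : ℕ) : ℝ) ∂ν ≤
          A * K ^ k * ∏ i : Fin k, ∫ ω, ((((box d (2 * R i) \ box d (R i)).filter fun x =>
            ω ∈ (openConn (0 : Site d) x : Set (BondConfig (Site d)))).card : ℕ) : ℝ) ∂ν := by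
  have hA2 := setToSetQuasiMultAspectAt_of_robustCondAnnulusUniq hd hl hcU.le hCU
  have hd0 : (0 : ℝ) < d := by exact_mod_cast (lt_of_lt_of_le (by norm_num) hd)
  exact exists_integral_prod_shellVolume_le_criticalProbI hd hl (by nlinarith) (by positivity) hA2 hl hcU hCU hUAD

open Classical in
/-- **PLANAR, UNCONDITIONAL: THE MIXED MOMENTS OF THE SHELL VOLUMES OF KESTEN'S PLANAR IIC FACTORISE**: at `p_c(ℤ²) = 1/2` there are `ρ', R₀ ≥ 1`
and `A, K > 0` with **`E_ν[∏_{i<k} V_{R_i}] ≤ A·K^k·∏_{i<k} E_ν[V_{R_i}]`** for every planar IIC measure `ν`, every `k ≥ 1` and radii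
`R_0 ≥ R₀`, `ρ'R_i ≤ R_{i+1}` (`V_R = |C(0) ∩ (Λ(2R) ∖ Λ(R))|`). [cite: Kesten1986, Thm. (8)] -/
theorem exists_integral_prod_shellVolume_le_Z2 :
    ∃ (ρ' R₀ : ℕ) (A K : ℝ), 1 ≤ ρ' ∧ 1 ≤ R₀ ∧ 0 < A ∧ 0 < K ∧ ∀ (ν : Measure (BondConfig (Site 2))) [IsFiniteMeasure ν],
      (∀ (F : Finset (Sym2 (Site 2))) (E : Set (BondConfig (Site 2))), MeasurableSet E → DeterminedBy E ↑F →
        Tendsto (fun n : ℕ => (bondPercolation (zdGraph 2) (criticalProbI 2)).real (E ∩ siteToBoundary 2 n) /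
          oneArmProb 2 (criticalProbI 2) n) atTop (𝓝 (ν.real E))) →
      ∀ (k : ℕ), 1 ≤ k → ∀ (R : Fin k → ℕ), (∀ i, R₀ ≤ R i) → (∀ i j : Fin k, i.val + 1 = j.val → ρ' * R i ≤ R j) →
        ∫ ω, ∏ i : Fin k, ((((box 2 (2 * R i) \ box 2 (R i)).filter fun x =>
            ω ∈ (openConn (0 : Site 2) x : Set (BondConfig (Site 2)))).card : ℕ) : ℝ) ∂ν ≤
          A * K ^ k * ∏ i : Fin k, ∫ ω, ((((box 2 (2 * R i) \ box 2 (R i)).filter fun x =>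
            ω ∈ (openConn (0 : Site 2) x : Set (BondConfig (Site 2)))).card : ℕ) : ℝ) ∂ν := by
  obtain ⟨cU, hcU, hCU⟩ := robustCondAnnulusUniq_Z2
  exact exists_integral_prod_shellVolume_le_criticalProbI_of_robustCondAnnulusUniq (d := 2) le_rfl (l := 9) (by norm_num) hcU
    (hCU 9 le_rfl) uad_Z2

end Summit.CriticalPhenomena.PercolationContinuityZ3.Theorems.Crossing

end
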